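import Literature.Computability.AlgebraicComplexity.StabilizerEigenbasisCharts
import Mathlib.Data.Finsupp.Weight
import HarnessLib

/-!
# Counting core for the generic trivial stabiliser (Matsumura–Monsky / BI 2017 §2.1):
# good monomials of a non-scalar diagonal matrix versus its cross pairs — infrastructure and `D ≥ 5`

Topic `Literature/Computability/AlgebraicComplexity`; theorems only (no definitions, no named
facts). Cell `val-lit`, row BI2017-A, Brick C of x3 g3's programme for the typed fact
`BI2017_matsumuraMonsky_trivialStabilizer` ("Matsumura and Monsky showed that if `D > 2` and `m > 3`,
then almost all `w ∈ Sym^D ℂ^m` have a trivial stabilizer", Bürgisser–Ikenmeyer 2017 §2.1), written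
by val-lit-p4 g5 under lead-bip g6's ruling 02:12Z.

THE INEQUALITY. For a field `K`, `c : [m] → K` non-constant (the eigenvalues of a non-scalar
diagonal matrix) and a degree `D`, let `S_c = {e ⊢ D : c^e := ∏_t c_t^{e_t} = 1}` (the monomials
fixed by `diag(c)`, x3's `invMonomials D c`) and `F(c) = #{(i,j) : c_i ≠ c_j}` (ordered cross pairs
= the number of free parameters of the pivot chart, x3's `card_chartVars`). The dimension count of
the programme needs `#S_c + F(c) < #{e ⊢ D}`. This file proves it for `D ≥ 5`, `m ≥ 3`
(`core_of_five_le`, `card_invMonomials_add_card_lt_of_five_le`); the cases `D = 4` and `D = 3`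
(`m ≥ 4`) follow in sibling files on the same infrastructure.

THE ARGUMENT (a `c`-dependent injection, not a matching — for patterns with many eigenvalue blocks
a matching of size `F(c)+1` in the transfer graph does not exist): two monomials that differ by
moving one unit of exponent from `x_j` to `x_i` with `c_i ≠ c_j` are never both good
(`not_both_one_of_ne`); so the ordered cross pair `(i,j)` can be charged to `x_i x_j^{D-1}` if that
monomial is bad and to `x_i^2 x_j^{D-2}` otherwise; for `D ≥ 5` the exponent patterns `(1, D-1)` and
`(2, D-2)` determine the ordered pair and are distinct, so the charge is injective into the bad
monomials; one more bad monomial with THREE letters (`x_{i₀}^a x_{j₀}^b x_l^{D-3}`, `{a,b} = {1,2}`,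
again by the transfer argument) is never charged. Bookkeeping: `core_of_injection`.

HONEST FRAMING: elementary counting inside a classical genericity theorem (Matsumura–Monsky 1964)
filed as literature bookkeeping; nothing here bears on permanent versus determinant; VP ≠ VNP is NOT
proved and nothing in this file is progress on it.

## References
* [BurgisserIkenmeyer2017] P. Bürgisser, C. Ikenmeyer, J. Algebra 477 (2017), §2.1 (before Thm. 2.3).
* [MatsumuraMonsky1963] H. Matsumura, P. Monsky, J. Math. Kyoto Univ. 3 (1963/64) 347–361.

## Tree
`degMonomials`, `mem_degMonomials_iff` (`OrbitCoordinateRing`); `invMonomials`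
(`StabilizerEigenbasisCharts.lean`, x3 g3); consumer-to-be `GenericTrivialStabilizerProofs.lean`
(x3 g3) via `isZariskiGeneric_not_mem_chartImage` (`FormChartDimensionCount.lean`).
-/

noncomputable section

open scoped BigOperators

namespace Literature.Computability.AlgebraicComplexity

namespace TrivialStabilizerCount

open scoped Classical

variable {K : Type*} [Field K] {m : ℕ}

/-! ### §1 Exponent vectors with two or three letters -/

/-- `x_i^a x_j^b` has degree `a + b`. [cite: BurgisserIkenmeyer2017, §2.1 (generic stabilizer; Matsumura–Monsky)] -/
theorem single_add_single_mem (i j : Fin m) {a b D : ℕ} (h : a + b = D) :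
    Finsupp.single i a + Finsupp.single j b ∈ degMonomials (Fin m) D := by
  rw [mem_degMonomials_iff, map_add, Finsupp.degree_single, Finsupp.degree_single, h]

/-- `x_i^a x_j^b x_l^e` has degree `a + b + e`. [cite: BurgisserIkenmeyer2017, §2.1 (generic stabilizer; Matsumura–Monsky)] -/
theorem single_add_single_add_single_mem (i j l : Fin m) {a b e D : ℕ} (h : a + b + e = D) :
    Finsupp.single i a + Finsupp.single j b + Finsupp.single l e ∈ degMonomials (Fin m) D := by
  rw [mem_degMonomials_iff, map_add, map_add, Finsupp.degree_single, Finsupp.degree_single,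
    Finsupp.degree_single, h]

/-- Evaluation of a two-letter exponent vector. [cite: BurgisserIkenmeyer2017, §2.1 (generic stabilizer; Matsumura–Monsky)] -/
theorem two_apply (i j t : Fin m) (a b : ℕ) :
    (Finsupp.single i a + Finsupp.single j b) t = (if i = t then a else 0) + (if j = t then b else 0) := by
  simp only [Finsupp.add_apply, Finsupp.single_apply]

/-- Evaluation of a three-letter exponent vector. [cite: BurgisserIkenmeyer2017, §2.1 (generic stabilizer; Matsumura–Monsky)] -/
theorem three_apply (i j l t : Fin m) (a b e : ℕ) :
    (Finsupp.single i a + Finsupp.single j b + Finsupp.single l e) t =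
      (if i = t then a else 0) + (if j = t then b else 0) + (if l = t then e else 0) := by
  simp only [Finsupp.add_apply, Finsupp.single_apply]

/-! ### §2 Values `c^e = ∏ c_t^{e_t}` of a diagonal matrix on monomials -/

/-- `c^{f+g} = c^f c^g`. [cite: BurgisserIkenmeyer2017, §2.1 (generic stabilizer; Matsumura–Monsky)] -/
theorem prod_pow_add_apply (c : Fin m → K) (f g : Fin m →₀ ℕ) :
    ∏ t, c t ^ ((f + g) t) = (∏ t, c t ^ f t) * ∏ t, c t ^ g t := by
  rw [← Finset.prod_mul_distrib]
  refine Finset.prod_congr rfl fun t _ => ?_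
  rw [Finsupp.add_apply, pow_add]

/-- `c^{a ε_i} = c_i^a`. [cite: BurgisserIkenmeyer2017, §2.1 (generic stabilizer; Matsumura–Monsky)] -/
theorem prod_pow_single_apply (c : Fin m → K) (i : Fin m) (a : ℕ) :
    ∏ t, c t ^ (Finsupp.single i a t) = c i ^ a := by
  rw [Finset.prod_eq_single i (fun t _ ht => by rw [Finsupp.single_eq_of_ne ht, pow_zero])
    (fun h => absurd (Finset.mem_univ i) h), Finsupp.single_eq_same]

/-- The value on `x_i^a x_j^b`. [cite: BurgisserIkenmeyer2017, §2.1 (generic stabilizer; Matsumura–Monsky)] -/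
theorem prod_pow_two (c : Fin m → K) (i j : Fin m) (a b : ℕ) :
    ∏ t, c t ^ ((Finsupp.single i a + Finsupp.single j b) t) = c i ^ a * c j ^ b := by
  rw [prod_pow_add_apply, prod_pow_single_apply, prod_pow_single_apply]

/-- The value on `x_i^a x_j^b x_l^e`. [cite: BurgisserIkenmeyer2017, §2.1 (generic stabilizer; Matsumura–Monsky)] -/
theorem prod_pow_three (c : Fin m → K) (i j l : Fin m) (a b e : ℕ) :
    ∏ t, c t ^ ((Finsupp.single i a + Finsupp.single j b + Finsupp.single l e) t) =
      c i ^ a * c j ^ b * c l ^ e := by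
  rw [prod_pow_add_apply, prod_pow_two, prod_pow_single_apply]

/-- **Adjacent monomials are not both good.** If `c_i ≠ c_j` then `x_i^{a+1} x_j^b · R` and
`x_i^a x_j^{b+1} · R` (one unit moved from `j` to `i`) cannot both have value `1`.
[cite: BurgisserIkenmeyer2017, §2.1 (generic stabilizer; Matsumura–Monsky)] -/
theorem not_both_one_of_ne {c : Fin m → K} {i j : Fin m} (hij : c i ≠ c j) (a b : ℕ) (R : K)
    (h1 : c i ^ (a + 1) * c j ^ b * R = 1) (h2 : c i ^ a * c j ^ (b + 1) * R = 1) : False := by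
  have hne : c i ^ a * c j ^ b * R ≠ 0 := by
    intro h0
    rw [pow_succ, show c i ^ a * c i * c j ^ b * R = c i * (c i ^ a * c j ^ b * R) by ring, h0,
      mul_zero] at h1
    exact zero_ne_one h1
  apply hij
  have : c i * (c i ^ a * c j ^ b * R) = c j * (c i ^ a * c j ^ b * R) := by
    calc c i * (c i ^ a * c j ^ b * R) = c i ^ (a + 1) * c j ^ b * R := by ring
      _ = 1 := h1
      _ = c i ^ a * c j ^ (b + 1) * R := h2.symm
      _ = c j * (c i ^ a * c j ^ b * R) := by ring
  exact mul_right_cancel₀ hne this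

/-! ### §3 Bookkeeping: good + bad = all -/

/-- `#good + #bad = #monomials`. [cite: BurgisserIkenmeyer2017, §2.1 (generic stabilizer; Matsumura–Monsky)] -/
theorem card_good_add_card_bad (D : ℕ) (c : Fin m → K) :
    ((degMonomials (Fin m) D).filter fun e => ∏ t, c t ^ e t = 1).card +
      ((degMonomials (Fin m) D).filter fun e => ¬ ∏ t, c t ^ e t = 1).card =
        (degMonomials (Fin m) D).card := by
  rw [Finset.card_filter_add_card_filter_not]

/-- The counting principle: an injection of the cross pairs into the bad monomials of degree `D`
missing one bad monomial gives `#good + #cross + 1 ≤ #monomials`. [cite: BurgisserIkenmeyer2017, §2.1 (generic stabilizer; Matsumura–Monsky)] -/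
theorem core_of_injection (D : ℕ) (c : Fin m → K) (Ψ : Fin m × Fin m → (Fin m →₀ ℕ))
    (e₀ : Fin m →₀ ℕ) (he₀D : e₀ ∈ degMonomials (Fin m) D) (he₀ : ¬ ∏ t, c t ^ e₀ t = 1)
    (hΨD : ∀ p : Fin m × Fin m, c p.1 ≠ c p.2 → Ψ p ∈ degMonomials (Fin m) D)
    (hbad : ∀ p : Fin m × Fin m, c p.1 ≠ c p.2 → ¬ ∏ t, c t ^ (Ψ p) t = 1)
    (hmiss : ∀ p : Fin m × Fin m, c p.1 ≠ c p.2 → Ψ p ≠ e₀)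
    (hinj : Set.InjOn Ψ {p : Fin m × Fin m | c p.1 ≠ c p.2}) :
    ((degMonomials (Fin m) D).filter fun e => ∏ t, c t ^ e t = 1).card +
      (Finset.univ.filter fun p : Fin m × Fin m => c p.1 ≠ c p.2).card + 1 ≤
        (degMonomials (Fin m) D).card := by
  rw [← card_good_add_card_bad D c]
  have h : (Finset.univ.filter fun p : Fin m × Fin m => c p.1 ≠ c p.2).card ≤
      (((degMonomials (Fin m) D).filter fun e => ¬ ∏ t, c t ^ e t = 1).erase e₀).card := by
    refine Finset.card_le_card_of_injOn Ψ (fun p hp => ?_) (fun p hp q hq hpq => ?_)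
    · have hp' : c p.1 ≠ c p.2 := (Finset.mem_filter.mp hp).2
      exact Finset.mem_erase.mpr ⟨hmiss p hp', Finset.mem_filter.mpr ⟨hΨD p hp', hbad p hp'⟩⟩
    · exact hinj (Finset.mem_filter.mp hp).2 (Finset.mem_filter.mp hq).2 hpq
  have hmem : e₀ ∈ (degMonomials (Fin m) D).filter fun e => ¬ ∏ t, c t ^ e t = 1 :=
    Finset.mem_filter.mpr ⟨he₀D, he₀⟩
  rw [Finset.card_erase_of_mem hmem] at h
  have hpos := Finset.card_pos.mpr ⟨e₀, hmem⟩
  omega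

/-! ### §4 Pattern lemmas: which two-letter exponent vectors coincide -/

/-- `x_i^a x_j^b = x_{i'}^a x_{j'}^b` with `i ≠ j`, `a, b > 0`, `a ≠ b` forces
`(i, j) = (i', j')`. [cite: BurgisserIkenmeyer2017, §2.1 (generic stabilizer; Matsumura–Monsky)] -/
theorem eq_of_two_eq_two {i j i' j' : Fin m} {a b : ℕ} (hij : i ≠ j)
    (ha : 0 < a) (hb : 0 < b) (hab : a ≠ b)
    (h : Finsupp.single i a + Finsupp.single j b = Finsupp.single i' a + Finsupp.single j' b) :
    i' = i ∧ j' = j := by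
  have hi := DFunLike.congr_fun h i
  have hj := DFunLike.congr_fun h j
  rw [two_apply, two_apply, if_pos rfl, if_neg (Ne.symm hij)] at hi
  rw [two_apply, two_apply, if_neg hij, if_pos rfl] at hj
  have h1 : i' = i := by
    by_cases h1 : i' = i
    · exact h1
    · by_cases h2 : j' = i
      · rw [if_neg h1, if_pos h2] at hi
        omega
      · rw [if_neg h1, if_neg h2] at hi
        omega
  refine ⟨h1, ?_⟩
  have h3 : ¬ i' = j := fun h => hij (h1.symm.trans h)
  by_cases h4 : j' = j
  · exact h4
  · rw [if_neg h3, if_neg h4] at hj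
    omega

/-- `x_i^1 x_j^{b} ≠ x_{i'}^2 x_{j'}^{b'}` when `i ≠ j` and `b' ∉ {1}` with `b' ≥ 3` (used with
`(b, b') = (D-1, D-2)`, `D ≥ 5`). [cite: BurgisserIkenmeyer2017, §2.1 (generic stabilizer; Matsumura–Monsky)] -/
theorem two_one_ne_two_two {i j i' j' : Fin m} {b b' : ℕ} (hij : i ≠ j) (hb' : 3 ≤ b') :
    Finsupp.single i 1 + Finsupp.single j b ≠ Finsupp.single i' 2 + Finsupp.single j' b' := by
  intro h
  have hi := DFunLike.congr_fun h i
  rw [two_apply, two_apply, if_pos rfl, if_neg (Ne.symm hij)] at hi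
  by_cases h1 : i' = i <;> by_cases h2 : j' = i <;> simp only [h1, h2, if_true, if_false] at hi <;> omega

/-- A two-letter exponent vector is not an exponent vector with three letters of positive
exponent. [cite: BurgisserIkenmeyer2017, §2.1 (generic stabilizer; Matsumura–Monsky)] -/
theorem two_ne_of_three_pos {i j : Fin m} {a b : ℕ} {g : Fin m →₀ ℕ} {p q r : Fin m}
    (hpq : p ≠ q) (hqr : q ≠ r) (hpr : p ≠ r) (hp : 0 < g p) (hq : 0 < g q) (hr : 0 < g r) :
    Finsupp.single i a + Finsupp.single j b ≠ g := by
  intro h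
  have key : ∀ t, t ≠ i → t ≠ j → g t = 0 := fun t hti htj => by
    rw [← h, two_apply, if_neg (Ne.symm hti), if_neg (Ne.symm htj)]
  have hp' : p = i ∨ p = j := by
    by_contra hn
    push Not at hn
    exact hp.ne' (key p hn.1 hn.2)
  have hq' : q = i ∨ q = j := by
    by_contra hn
    push Not at hn
    exact hq.ne' (key q hn.1 hn.2)
  have hr' : r = i ∨ r = j := by
    by_contra hn
    push Not at hn
    exact hr.ne' (key r hn.1 hn.2)
  rcases hp' with hp' | hp' <;> rcases hq' with hq' | hq' <;> rcases hr' with hr' | hr'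
  · exact hpq (hp'.trans hq'.symm)
  · exact hpq (hp'.trans hq'.symm)
  · exact hpr (hp'.trans hr'.symm)
  · exact hqr (hq'.trans hr'.symm)
  · exact hqr (hq'.trans hr'.symm)
  · exact hpr (hp'.trans hr'.symm)
  · exact hpq (hp'.trans hq'.symm)
  · exact hpq (hp'.trans hq'.symm)

/-- In `Fin m` with `m ≥ 3` there is an index different from two given ones. [cite: BurgisserIkenmeyer2017, §2.1 (generic stabilizer; Matsumura–Monsky)] -/
theorem exists_ne_ne (hm : 3 ≤ m) (i j : Fin m) : ∃ l : Fin m, l ≠ i ∧ l ≠ j := by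
  by_contra h
  push Not at h
  have hsub : (Finset.univ : Finset (Fin m)) ⊆ {i, j} := fun l _ => by
    rcases eq_or_ne l i with h1 | h1
    · simp [h1]
    · simp [h l h1]
  have := (Finset.card_le_card hsub).trans (Finset.card_insert_le i {j})
  rw [Finset.card_univ, Fintype.card_fin, Finset.card_singleton] at this
  omega

/-! ### §5 The case `D ≥ 5` -/

/-- **Counting core, `D ≥ 5`, `m ≥ 3`.** For a non-constant `c : [m] → K` (diagonal matrix with at
least two eigenvalues), `#{e ⊢ D : c^e = 1} + #{(i,j) : c_i ≠ c_j} + 1 ≤ #{e ⊢ D}`. The ordered cross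
pair `(i, j)` is charged to the BAD monomial `x_i x_j^{D-1}` if that one is bad and otherwise to
`x_i² x_j^{D-2}` (bad, since two monomials differing by a unit transfer between distinct eigenvalues
are not both good); for `D ≥ 5` the exponent patterns `(1, D-1)`, `(2, D-2)` make this injective, and a
three-letter bad monomial `x_{i₀}^a x_{j₀}^b x_l^{D-3}` (`{a,b} = {1,2}`) is left over.
[cite: BurgisserIkenmeyer2017, §2.1 (generic stabilizer; Matsumura–Monsky)] -/
theorem core_of_five_le {D : ℕ} (hD : 5 ≤ D) (hm : 3 ≤ m) (c : Fin m → K)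
    (hnc : ∃ i j, c i ≠ c j) :
    ((degMonomials (Fin m) D).filter fun e => ∏ t, c t ^ e t = 1).card +
      (Finset.univ.filter fun p : Fin m × Fin m => c p.1 ≠ c p.2).card + 1 ≤
        (degMonomials (Fin m) D).card := by
  obtain ⟨i₀, j₀, h0⟩ := hnc
  have hij₀ : i₀ ≠ j₀ := fun h => h0 (h ▸ rfl)
  obtain ⟨l, hli, hlj⟩ := exists_ne_ne hm i₀ j₀
  -- the charged monomials
  let M1 : Fin m × Fin m → (Fin m →₀ ℕ) := fun p =>
    Finsupp.single p.1 1 + Finsupp.single p.2 (D - 1)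
  let M2 : Fin m × Fin m → (Fin m →₀ ℕ) := fun p =>
    Finsupp.single p.1 2 + Finsupp.single p.2 (D - 2)
  let Ψ : Fin m × Fin m → (Fin m →₀ ℕ) := fun p =>
    if ∏ t, c t ^ M1 p t = 1 then M2 p else M1 p
  -- the left-over monomial
  let T1 : Fin m →₀ ℕ := Finsupp.single i₀ 1 + Finsupp.single j₀ 2 + Finsupp.single l (D - 3)
  let T2 : Fin m →₀ ℕ := Finsupp.single i₀ 2 + Finsupp.single j₀ 1 + Finsupp.single l (D - 3)
  let e₀ : Fin m →₀ ℕ := if ∏ t, c t ^ T1 t = 1 then T2 else T1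
  have hT1 : ∏ t, c t ^ T1 t = c i₀ ^ 1 * c j₀ ^ (1 + 1) * c l ^ (D - 3) := by
    show ∏ t, c t ^ ((Finsupp.single i₀ 1 + Finsupp.single j₀ 2 + Finsupp.single l (D - 3) :
      Fin m →₀ ℕ) t) = _
    rw [prod_pow_three]
  have hT2 : ∏ t, c t ^ T2 t = c i₀ ^ (1 + 1) * c j₀ ^ 1 * c l ^ (D - 3) := by
    show ∏ t, c t ^ ((Finsupp.single i₀ 2 + Finsupp.single j₀ 1 + Finsupp.single l (D - 3) :
      Fin m →₀ ℕ) t) = _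
    rw [prod_pow_three]
  have hM1 : ∀ p : Fin m × Fin m, ∏ t, c t ^ M1 p t = c p.1 ^ 1 * c p.2 ^ (D - 2 + 1) * 1 := by
    intro p
    show ∏ t, c t ^ ((Finsupp.single p.1 1 + Finsupp.single p.2 (D - 1) : Fin m →₀ ℕ) t) = _
    rw [prod_pow_two, mul_one, show D - 2 + 1 = D - 1 by omega]
  have hM2 : ∀ p : Fin m × Fin m, ∏ t, c t ^ M2 p t = c p.1 ^ (1 + 1) * c p.2 ^ (D - 2) * 1 := by
    intro p
    show ∏ t, c t ^ ((Finsupp.single p.1 2 + Finsupp.single p.2 (D - 2) : Fin m →₀ ℕ) t) = _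
    rw [prod_pow_two, mul_one]
  refine core_of_injection D c Ψ e₀ ?_ ?_ ?_ ?_ ?_ ?_
  · -- `e₀` has degree `D`
    show (if ∏ t, c t ^ T1 t = 1 then T2 else T1) ∈ degMonomials (Fin m) D
    split_ifs
    · exact single_add_single_add_single_mem _ _ _ (by omega)
    · exact single_add_single_add_single_mem _ _ _ (by omega)
  · -- `e₀` is bad
    show ¬ ∏ t, c t ^ (if ∏ t, c t ^ T1 t = 1 then T2 else T1) t = 1
    split_ifs with hgood
    · intro hT2good
      rw [hT1] at hgood
      rw [hT2] at hT2good
      exact not_both_one_of_ne h0 1 1 _ hT2good hgood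
    · exact hgood
  · -- the charged monomials have degree `D`
    intro p _
    show (if ∏ t, c t ^ M1 p t = 1 then M2 p else M1 p) ∈ degMonomials (Fin m) D
    split_ifs
    · exact single_add_single_mem _ _ (by omega)
    · exact single_add_single_mem _ _ (by omega)
  · -- every charged monomial is bad
    intro p hp
    show ¬ ∏ t, c t ^ (if ∏ t, c t ^ M1 p t = 1 then M2 p else M1 p) t = 1
    split_ifs with hgood
    · intro h2
      rw [hM1] at hgood
      rw [hM2] at h2
      exact not_both_one_of_ne hp 1 (D - 2) 1 h2 hgood
    · exact hgood
  · -- the charged monomials miss `e₀`: they have two letters, `e₀` three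
    intro p _
    have he₀ : ∀ t ∈ ({i₀, j₀, l} : Finset (Fin m)), 0 < e₀ t := by
      intro t ht
      show 0 < (if ∏ t, c t ^ T1 t = 1 then T2 else T1) t
      simp only [Finset.mem_insert, Finset.mem_singleton] at ht
      split_ifs
      · show 0 < (Finsupp.single i₀ 2 + Finsupp.single j₀ 1 + Finsupp.single l (D - 3) : Fin m →₀ ℕ) t
        rw [three_apply]
        rcases ht with rfl | rfl | rfl
        · simp
        · simp [hij₀]
        · rw [if_neg (Ne.symm hli), if_neg (Ne.symm hlj), if_pos rfl]; omega
      · show 0 < (Finsupp.single i₀ 1 + Finsupp.single j₀ 2 + Finsupp.single l (D - 3) : Fin m →₀ ℕ) t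
        rw [three_apply]
        rcases ht with rfl | rfl | rfl
        · simp
        · simp [hij₀]
        · rw [if_neg (Ne.symm hli), if_neg (Ne.symm hlj), if_pos rfl]; omega
    have hp0 := he₀ i₀ (by simp)
    have hq0 := he₀ j₀ (by simp)
    have hr0 := he₀ l (by simp)
    show (if ∏ t, c t ^ M1 p t = 1 then M2 p else M1 p) ≠ e₀
    split_ifs
    · exact two_ne_of_three_pos hij₀ (Ne.symm hlj) (Ne.symm hli) hp0 hq0 hr0
    · exact two_ne_of_three_pos hij₀ (Ne.symm hlj) (Ne.symm hli) hp0 hq0 hr0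
  · -- injectivity on cross pairs
    intro p hp q hq hΨ
    have hp' : p.1 ≠ p.2 := fun h => hp (by rw [h])
    have hq' : q.1 ≠ q.2 := fun h => hq (by rw [h])
    revert hΨ
    show (if ∏ t, c t ^ M1 p t = 1 then M2 p else M1 p) =
      (if ∏ t, c t ^ M1 q t = 1 then M2 q else M1 q) → p = q
    split_ifs with h1 h2 h2
    · intro h
      obtain ⟨ha, hb⟩ := eq_of_two_eq_two hp' (by omega) (by omega) (by omega) h
      exact Prod.ext ha.symm hb.symm
    · intro h
      exact absurd h.symm (two_one_ne_two_two hq' (by omega))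
    · intro h
      exact absurd h (two_one_ne_two_two hp' (by omega))
    · intro h
      obtain ⟨ha, hb⟩ := eq_of_two_eq_two hp' (by omega) (by omega) (by omega) h
      exact Prod.ext ha.symm hb.symm

/-! ### §6 Bridge to the eigenbasis-chart vocabulary (`invMonomials`, x3 g3's F2) -/

/-- `invMonomials D c` is the set of good degree-`D` monomials in the `∏ t, c_t^{e_t}` form.
[cite: BurgisserIkenmeyer2017, §2.1 ("almost all w")] -/
theorem invMonomials_eq_filter (D : ℕ) (c : Fin m → K) :
    invMonomials D c = (degMonomials (Fin m) D).filter fun e => ∏ t, c t ^ e t = 1 := by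
  unfold invMonomials
  refine Finset.filter_congr fun e _ => ?_
  rw [Finsupp.prod_fintype _ _ fun i => pow_zero (c i)]

/-- **Counting core for `D ≥ 5` in chart vocabulary:** `#invMonomials D c + #{(i,j) : c_i ≠ c_j} <
#degMonomials` for non-constant `c`, `m ≥ 3` — the hypothesis of the dimension-count criterion
`isZariskiGeneric_not_mem_chartImage` (`FormChartDimensionCount.lean`) with `card_chartVars`
(`StabilizerEigenbasisCharts.lean`). [cite: BurgisserIkenmeyer2017, §2.1 ("almost all w ∈ Sym^D ℂ^m have a trivial stabilizer")] -/
theorem card_invMonomials_add_card_lt_of_five_le {D : ℕ} (hD : 5 ≤ D) (hm : 3 ≤ m)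
    (c : Fin m → K) (hnc : ∃ i j, c i ≠ c j) :
    (invMonomials D c).card + (Finset.univ.filter fun q : Fin m × Fin m => c q.1 ≠ c q.2).card <
      (degMonomials (Fin m) D).card := by
  rw [invMonomials_eq_filter]
  have := core_of_five_le hD hm c hnc
  omega

end TrivialStabilizerCount

end Literature.Computability.AlgebraicComplexity

end
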